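import Summits.Ventures.GridStability.Models.InverterDroopFirstOrderCCT
import Summits.Ventures.GridStability.Models.AngleEnclosure

/-!
# GridStability/Models/InverterDroopCSAQoriaP08 — instance «QORIA-V3-CSA-P08»: the printed CSA clearing-time case of Qoria 2020 §V.3 with certified numerals

Cell `gridfusion` (LADDER-GRIDFUSION, apex line G3.a; seat gridfusion-model-3 (g9); models/MODEL-3-NOTES.md
§1 (P23)). The generic theorems are in `Models/InverterDroopFirstOrderCCT.lean`; this file fixes the printed
operating point of [cite: Qoria2020, §V.3.4–§V.3.5] («for `p* = 0.8` p.u … the maximum fault duration based on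
CSA is `t_cSAT = 63.7` ms»; Fig. V-17: `t_fault = 63.7` ms recovers, `74` ms loses synchronism)
[corpus:paper:galaxy-pdf-947812980 p0106 L29–L39 ((V-27)–(V-28) L29–L31, the 63.7 ms sentence L39),
p0107 L10–L15] in the cell's exact conventions (A1″ circle
point, `ω_b′ = 35500/113`) and certifies: `0.2013 < δ₀′ < 0.2014`, `0.8411 < δ_maxSAT′ < 0.8412` (model-1's
`AngleEnclosure` chains), `0.0636 s < t_cSAT′ < 0.0637 s` (PRINTED 63.7 ms = VALIDATED comparator; float of
the exact model value 63.65 ms), `0.272 s < t_cc′ < 0.273 s` (no limiter; not printed), and the three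
hypothesis-free dichotomy sentences `csa_recovers` / `csa_loses` / `unlimited_cct` on the instance (+ §6 the
adaptive-gain scaling (V-30), + §4b a remark on the MODEL: the saturated branch's own attracting rest angle
`2π − δ_maxSAT`, `sat_rest` / `sat_decrease_far` — not a sentence of the print).
PROVENANCE P-INV-7 (droop gain of §V, see `qoriaV3p08`). THREE COLUMNS as in the generic file; MODELLED:
M_droop1 (MV-6D filter-less) + CSA branch + MV-P + MV-Ω; nothing here says a converter is stable.
-/

noncomputable section

open Real Set Filter Topology
open Summit.Ventures.GridStability.Models.AngleEnclosure

namespace Summit.Ventures.GridStability.Models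

namespace InverterDroop

/-! ## §4b A remark on the MODEL (not in the print): the saturated branch has its own attracting rest angle `2π − δ_maxSAT` -/

namespace ReducedParams

variable {P : ReducedParams}

/-- The saturated first-order field vanishes at `−δ_m` and at `2π − δ_m` (`cos` even and `2π`-periodic):
a CURRENT-SATURATED rest angle at which the saturated branch delivers exactly `p*` (`P_max3 cos δ_m = p*`).
A property of M_droop1+CSA, not a sentence of [cite: Qoria2020, §V.3.3] (which reads «loses the
synchronism»); printed analyses of saturated operating points: WANTED acq-13185 (Huang–Xin–Wang–Zhang–
Wu–Hu, IEEE TSG 2019, doi:10.1109/tsg.2017.2749259). -/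
theorem sat_rest (hω : P.ωset = P.ωe) {Imax Ve δm : ℝ} (heq : Imax * Ve * cos δm = P.pref) :
    P.dδFirstOrderSat Imax Ve (-δm) = 0 ∧ P.dδFirstOrderSat Imax Ve (2 * π - δm) = 0 := by
  rw [P.dδFirstOrderSat_eq hω, P.dδFirstOrderSat_eq hω, cos_neg, cos_two_pi_sub, ← heq]
  constructor <;> ring

/-- From the far side `(2π − δ_m, 2π + δ_m)` the saturated motion DECREASES monotonically to `2π − δ_m`.
With `sat_diverge` (increase to `2π − δ_m` from `(δ_m, 2π − δ_m)`): in the MODEL a converter that keeps its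
limiter active after a too-late clearing converges to the current-saturated synchronous angle
`2π − δ_maxSAT ≡ −δ_maxSAT (mod 2π)` from every clearing angle in `(δ_maxSAT, 2π + δ_maxSAT)`; whether a
real limiter releases there is outside M_droop1+CSA (MODEL-VALIDITY). -/
theorem sat_decrease_far (hω : P.ωset = P.ωe) (hk : 0 < P.ki) {Imax Ve : ℝ} (hP3 : 0 < Imax * Ve)
    {δm : ℝ} (hδm : δm ∈ Ioo 0 π) (heq : Imax * Ve * cos δm = P.pref)
    {δ : ℝ → ℝ} (hδ : P.IsFirstOrderSatSolutionOn Imax Ve δ (Ici 0))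
    (hc : δ 0 ∈ Ioo (2 * π - δm) (2 * π + δm)) :
    (∀ t, 0 ≤ t → 2 * π - δm < δ t ∧ δ t ≤ δ 0) ∧ AntitoneOn δ (Ici 0) ∧
      Tendsto δ atTop (𝓝 (2 * π - δm)) := by
  have hcos2 : cos (2 * π - δm) = cos δm := cos_two_pi_sub δm
  refine ScalarFlow.tendsto_of_neg (f := P.dδFirstOrderSat Imax Ve) (b := δ 0)
    (L := P.ki * (Imax * Ve)) hδ ⟨hc.1, le_rfl⟩ ?_ ?_ (P.continuous_dδFirstOrderSat Imax Ve).continuousOn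
  · intro y hy
    rw [P.dδFirstOrderSat_eq hω, ← heq]
    have h1 : cos δm < cos (y - 2 * π) :=
      ScalarFlow.cos_lt_cos_of_mem_inner hδm.2.le ⟨by linarith [hy.1], by linarith [hy.2, hc.2]⟩
    rw [cos_sub_two_pi] at h1
    rw [show P.ki * (Imax * Ve * cos δm - Imax * Ve * cos y) = P.ki * (Imax * Ve) * (cos δm - cos y)
      by ring]
    exact mul_neg_of_pos_of_neg (mul_pos hk hP3) (by linarith)
  · intro y hy
    rw [P.dδFirstOrderSat_eq hω, ← heq, ← hcos2]
    have := ScalarFlow.cos_sub_cos_le_sub hy.1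
    rw [show P.ki * (Imax * Ve * cos (2 * π - δm) - Imax * Ve * cos y)
        = -(P.ki * (Imax * Ve) * (cos y - cos (2 * π - δm))) by ring]
    exact neg_le_neg (mul_le_mul_of_nonneg_left this (mul_pos hk hP3).le)

end ReducedParams

/-! ## §5 Instance «QORIA-V3-CSA-P08»: the printed CSA case of §V.3 (p* = 0.8, I_maxSAT = 1.2, SCR = 10) -/

/-- The droop VSC of [cite: Qoria2020, §V.3] (negligible inertial effect, «Strategy C», quasi-static
model Fig. V-10 / V-14) at the printed operating point `p* = 0.8` p.u. [§V.3.4, text to Fig. V-15: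
«for `p* = 0.8` p.u … `t_cSAT = 63.7` ms»], as a `ReducedParams` record in the cell's conventions:
`ω_b′ = 35500/113` (token MV-Ω), `P_max = V_m V_e/(X_c + X_g) = 1/(0.15 + 1/SCR) = 4` (V-14) with
`V_m = V_e = 1`, SCR = 10 (Table V-1), droop `m_p = k_i/ω_b = 1/25` ⇒ `k_i = ω_b′/25 = 1420/113`
(PROVENANCE P-INV-7, adopted lead g8 RULING 9j (3), page read lit-2 16:18:41Z: Chapter V prints NO droop
gain — Table V-1 [p0102 L60–p0103 L6] has exactly six entries; `0.04` is the thesis's standing 4 % droop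
[Table III-1 p0058 L3–L6 «R 0.04 p.u»; mock-up Table VI-3 p0120 L34–L38 «`k_i/ω_b` 0.04 pu»] and the
value that (V-28) requires to reproduce the printed `63.7` ms (`m_p = 0.003` of the §III.4.2.2 damping
design [p0067 L24] would give `≈ 0.85` s); A1″ equilibrium representation: `δ₀′ = arcsin(1980/9901)` (circle point `t = 10/99`),
`p*′ := P_max sin δ₀′ = 7920/9901` (`p*′ − 0.8 ≈ −8.1·10⁻⁵`, token MV-P); `ω_set = ω_e = 1`;
`ω_c = 33` rad/s is NOT used by any first-order statement (carried for definiteness from §III.4.2.2).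
MODELLED: MV-6D (reduced droop GFM) in its filter-less limit + CSA branch (V-22); no VI, no inner loops. -/
def qoriaV3p08 : ReducedParams where
  ωb := 35500 / 113
  ωc := 33
  ki := 1420 / 113
  pref := 7920 / 9901
  Pmax := 4
  ωset := 1
  ωe := 1

/-- `P_max3 = I_maxSAT V_e = (6/5)·1` [cite: Qoria2020, (V-23), Table V-1 «`I_maxSAT` 1.2 p.u»]. -/
def qoriaV3_Imax : ℝ := 6 / 5

/-- Infinite-bus voltage `V_e = 1` p.u. -/
def qoriaV3_Ve : ℝ := 1

/-- The equilibrium angle of record `δ₀′ = arcsin(1980/9901)` (A1″ circle point; `δ₀ = arcsin(p*/P_max)`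
(V-15)). -/
def qoriaV3p08_δ0 : ℝ := arcsin (1980 / 9901)

/-- The critical clearing angle under the CSA, `δ_maxSAT′ = arccos(p*′/P_max3) = arccos(6600/9901)`
(V-24). -/
def qoriaV3p08_δm : ℝ := arccos (6600 / 9901)

namespace qoriaV3p08

/-- `sin δ₀′ = 1980/9901`. -/
theorem sin_δ0 : sin qoriaV3p08_δ0 = 1980 / 9901 := by
  unfold qoriaV3p08_δ0; rw [sin_arcsin] <;> norm_num

/-- `cos δ₀′ = 9701/9901` (`1980² + 9701² = 9901²`). -/
theorem cos_δ0 : cos qoriaV3p08_δ0 = 9701 / 9901 := by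
  unfold qoriaV3p08_δ0
  rw [cos_arcsin]
  have h : (1 : ℝ) - (1980 / 9901) ^ 2 = (9701 / 9901) ^ 2 := by norm_num
  rw [h, sqrt_sq]
  norm_num

/-- `cos δ_maxSAT′ = 6600/9901`. -/
theorem cos_δm : cos qoriaV3p08_δm = 6600 / 9901 := by
  unfold qoriaV3p08_δm; rw [cos_arccos] <;> norm_num

/-- `δ₀′ ∈ (0, π/2)`. -/
theorem δ0_mem : qoriaV3p08_δ0 ∈ Ioo 0 (π / 2) :=
  ⟨arcsin_pos.2 (by norm_num), arcsin_lt_pi_div_two.2 (by norm_num)⟩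

/-- `δ_maxSAT′ ∈ (0, π/2]`. -/
theorem δm_mem : qoriaV3p08_δm ∈ Ioc 0 (π / 2) :=
  ⟨arccos_pos.2 (by norm_num), arccos_le_pi_div_two.2 (by norm_num)⟩

/-- Power balance at `δ₀′` (eq=b, EXACT): `P_max sin δ₀′ = p*′`. -/
theorem power_balance : qoriaV3p08.Pmax * sin qoriaV3p08_δ0 = qoriaV3p08.pref := by
  rw [sin_δ0]; norm_num [qoriaV3p08]

/-- Saturated power balance at `δ_maxSAT′` (EXACT): `P_max3 cos δ_maxSAT′ = p*′`. -/
theorem sat_balance : qoriaV3_Imax * qoriaV3_Ve * cos qoriaV3p08_δm = qoriaV3p08.pref := by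
  rw [cos_δm]; norm_num [qoriaV3p08, qoriaV3_Imax, qoriaV3_Ve]

/-- Certified enclosure `0.2013 < δ₀′ < 0.2014` (model-1's `AngleEnclosure` chains; float `0.2013373`). -/
theorem δ0_bounds : (2013 / 10000 : ℝ) < qoriaV3p08_δ0 ∧ qoriaV3p08_δ0 < 2014 / 10000 := by
  constructor
  · refine arcsin_gt_of_chain cos_δ0 (by norm_num) (by linarith [pi_gt_three]) ?_ ?_ ?_ ?_ ?_ <;>
      norm_num [dbl, cosLower4]
  · refine arcsin_lt_of_chain cos_δ0 (by norm_num) (by linarith [pi_gt_three]) ?_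
    norm_num [dbl, cosUpper4]

/-- Certified enclosure `0.8411 < δ_maxSAT′ < 0.8412` (float `0.8411590`). -/
theorem δm_bounds : (8411 / 10000 : ℝ) < qoriaV3p08_δm ∧ qoriaV3p08_δm < 8412 / 10000 := by
  have h0 : 0 ≤ qoriaV3p08_δm := arccos_nonneg _
  have hπ : qoriaV3p08_δm ≤ π := arccos_le_pi _
  constructor
  · refine angle_gt_of_chain5 h0 (by linarith [pi_gt_three]) ?_ ?_ ?_ ?_ ?_ ?_ <;>
      norm_num [dbl, cosLower5, cos_δm]
  · refine angle_lt_of_chain hπ (by norm_num) (by linarith [pi_gt_three]) ?_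
    norm_num [dbl, cosUpper4, cos_δm]

/-- **Certified CSA clearing time of the instance:** `0.0636 s < t_cSAT′ < 0.0637 s`
(`t_cSAT′ = (δ_maxSAT′ − δ₀′)/(k_i p*′)`, `k_i p*′ = 11246400/1118813 ≈ 10.052 s⁻¹`; float `63.65` ms;
PRINTED: «`t_cSAT = 63.7` ms» — VALIDATED comparator [cite: Qoria2020, §V.3.4; Fig. V-17.a]). -/
theorem tcSat_bounds :
    (636 / 10000 : ℝ) < qoriaV3p08.tcSat qoriaV3p08_δ0 qoriaV3p08_δm ∧
      qoriaV3p08.tcSat qoriaV3p08_δ0 qoriaV3p08_δm < 637 / 10000 := by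
  obtain ⟨h1, h2⟩ := δ0_bounds
  obtain ⟨h3, h4⟩ := δm_bounds
  unfold ReducedParams.tcSat
  simp only [qoriaV3p08]
  constructor
  · rw [lt_div_iff₀ (by norm_num)]; linarith
  · rw [div_lt_iff₀ (by norm_num)]; linarith

/-- **Certified UNCONSTRAINED clearing time of the instance:** `0.272 s < t_cc′ < 0.273 s`
(`t_cc′ = (π − 2δ₀′)/(k_i p*′)`; float `272.5` ms; no printed comparator — the thesis prints the VI and
CSA cases only) ⇒ at this operating point the CSA costs a factor `> 4.27` in certified clearing time. -/
theorem tcc_bounds :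
    (272 / 1000 : ℝ) < qoriaV3p08.tcc qoriaV3p08_δ0 ∧ qoriaV3p08.tcc qoriaV3p08_δ0 < 273 / 1000 := by
  obtain ⟨h1, h2⟩ := δ0_bounds
  unfold ReducedParams.tcc
  simp only [qoriaV3p08]
  constructor
  · rw [lt_div_iff₀ (by norm_num)]; linarith [pi_gt_d4]
  · rw [div_lt_iff₀ (by norm_num)]; linarith [pi_lt_d4]

/-- **«QORIA-V3-CSA-P08», recovery side.** Every bolted fault of duration `0 < t_f < t_cSAT′` (in
particular every `t_f ≤ 63.6` ms) cleared onto a current-saturated converter: for EVERY switching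
instant `t_d ≥ 0`, every post-fault motion (saturated on `[0, t_d]`, unsaturated after) returns to
`δ₀′` [cite: Qoria2020, §V.3.5, Fig. V-17.a «recovers … when `t_fault ≤ t_cSAT`»]. MODELLED: M_droop1
+ CSA branch; nothing about any converter. -/
theorem csa_recovers {tf : ℝ} (htf : 0 < tf)
    (hlt : tf < qoriaV3p08.tcSat qoriaV3p08_δ0 qoriaV3p08_δm) {td : ℝ} (htd : 0 ≤ td) {δ : ℝ → ℝ}
    (hsat : qoriaV3p08.IsFirstOrderSatSolutionOn qoriaV3_Imax qoriaV3_Ve δ (Icc 0 td))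
    (hunsat : qoriaV3p08.IsFirstOrderSolutionOn (fun s => δ (td + s)) (Ici 0))
    (h0 : δ 0 = qoriaV3p08.faultOn qoriaV3p08_δ0 tf) : Tendsto δ atTop (𝓝 qoriaV3p08_δ0) :=
  (ReducedParams.csa_cct_exact (P := qoriaV3p08) rfl (by norm_num [qoriaV3p08])
    (by norm_num [qoriaV3p08]) (by norm_num [qoriaV3p08])
    (by norm_num [qoriaV3_Imax, qoriaV3_Ve]) δ0_mem power_balance δm_mem sat_balance htf).1
    hlt td htd δ hsat hunsat h0

/-- **«QORIA-V3-CSA-P08», loss side.** Every bolted fault with `t_cSAT′ < t_f ≤ 1/2` s (in particular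
every `t_f ≥ 63.7` ms up to half a second) cleared onto a converter that stays current-saturated: the
angle increases monotonically above `δ_maxSAT′` towards `2π − δ_maxSAT′` — no return to `δ₀′`
[cite: Qoria2020, §V.3.5, Fig. V-17.b «loses the synchronism when `t_fault > t_cSAT`» (there: 74 ms)]. -/
theorem csa_loses {tf : ℝ} (hlt : qoriaV3p08.tcSat qoriaV3p08_δ0 qoriaV3p08_δm < tf)
    (htf2 : tf ≤ 1 / 2) {δ : ℝ → ℝ}
    (hsat : qoriaV3p08.IsFirstOrderSatSolutionOn qoriaV3_Imax qoriaV3_Ve δ (Ici 0))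
    (h0 : δ 0 = qoriaV3p08.faultOn qoriaV3p08_δ0 tf) :
    (∀ t, 0 ≤ t → qoriaV3p08_δm < δ t) ∧ MonotoneOn δ (Ici 0) ∧
      Tendsto δ atTop (𝓝 (2 * π - qoriaV3p08_δm)) := by
  have htf : 0 < tf := lt_trans (lt_trans (by norm_num) tcSat_bounds.1) hlt
  have hguard : qoriaV3p08.faultOn qoriaV3p08_δ0 tf < 2 * π - qoriaV3p08_δm := by
    unfold ReducedParams.faultOn
    simp only [qoriaV3p08]
    nlinarith [δ0_bounds.2, δm_bounds.2, pi_gt_d4]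
  exact (ReducedParams.csa_cct_exact (P := qoriaV3p08) rfl (by norm_num [qoriaV3p08])
    (by norm_num [qoriaV3p08]) (by norm_num [qoriaV3p08])
    (by norm_num [qoriaV3_Imax, qoriaV3_Ve]) δ0_mem power_balance δm_mem sat_balance htf).2
    hlt hguard δ hsat h0

/-- **«QORIA-V3-CSA-P08» WITHOUT the limiter (the converter of Fig. V-10/V-11): exact CCT dichotomy.**
`t_f < t_cc′` (in particular `t_f ≤ 0.272` s) ⇒ every post-fault motion returns to `δ₀′`;
`t_cc′ < t_f ≤ 0.6` s ⇒ every post-fault motion stays above `π − δ₀′` and pole-slips to `2π + δ₀′`. -/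
theorem unlimited_cct {tf : ℝ} (htf : 0 < tf) {δ : ℝ → ℝ}
    (hδ : qoriaV3p08.IsFirstOrderSolutionOn δ (Ici 0)) (h0 : δ 0 = qoriaV3p08.faultOn qoriaV3p08_δ0 tf) :
    (tf < qoriaV3p08.tcc qoriaV3p08_δ0 → Tendsto δ atTop (𝓝 qoriaV3p08_δ0)) ∧
    (qoriaV3p08.tcc qoriaV3p08_δ0 < tf → tf ≤ 6 / 10 →
      (∀ t, 0 ≤ t → π - qoriaV3p08_δ0 < δ t) ∧ Tendsto δ atTop (𝓝 (2 * π + qoriaV3p08_δ0))) := by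
  have h := ReducedParams.firstOrder_cct_exact (P := qoriaV3p08) rfl (by norm_num [qoriaV3p08])
    (by norm_num [qoriaV3p08]) (by norm_num [qoriaV3p08]) δ0_mem power_balance htf hδ h0
  refine ⟨h.1, fun hlt htf2 => h.2 hlt ?_⟩
  unfold ReducedParams.faultOn
  simp only [qoriaV3p08]
  nlinarith [δ0_bounds.1, pi_gt_d4]

end qoriaV3p08


/-! ## §6 Variable droop gain during the fault [cite: Qoria2020, §V.5.1 (V-30)–(V-31)]: exact scaling of the clearing times -/

/-- (V-30)–(V-31): with the droop gain scaled to `α k_i` DURING the fault (`α = 0.1` while `I_s > 1` p.u.)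
the fault-on motion of the scaled record is the fault-on motion of the nominal record read at time `α t`
(slope `α k_i p*`) — so every clearing-time threshold of §3–§5 is divided by `α` EXACTLY («by decreasing
`k_i` or `p*` during the fault, the critical clearing time increases» [cite: Qoria2020, §V.5]). -/
theorem faultOn_scaled (P : ReducedParams) (α δ₀ t : ℝ) :
    ({ P with ki := α * P.ki } : ReducedParams).faultOn δ₀ t = P.faultOn δ₀ (α * t) := by
  simp only [ReducedParams.faultOn]; ring

/-- **«QORIA-V3-CSA-P08» with the 1st adaptive-gain solution (`α = 1/10` during the fault), recovery
side:** every bolted fault of duration `0 < t_f < 10 · t_cSAT′` (in particular every `t_f ≤ 0.636` s)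
cleared onto a current-saturated converter whose post-fault gain is back to `k_i` returns to `δ₀′`, for
every switching instant `t_d ≥ 0` (exact tenfold clearing time of the MODEL; the print's Fig. V-23 case is
`p* = 0.9` with the HCLC — VALIDATED, qualitative only). -/
theorem csa_recovers_adaptive {tf : ℝ} (htf : 0 < tf)
    (hlt : tf / 10 < qoriaV3p08.tcSat qoriaV3p08_δ0 qoriaV3p08_δm) {td : ℝ} (htd : 0 ≤ td) {δ : ℝ → ℝ}
    (hsat : qoriaV3p08.IsFirstOrderSatSolutionOn qoriaV3_Imax qoriaV3_Ve δ (Icc 0 td))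
    (hunsat : qoriaV3p08.IsFirstOrderSolutionOn (fun s => δ (td + s)) (Ici 0))
    (h0 : δ 0 = ({ qoriaV3p08 with ki := 1 / 10 * qoriaV3p08.ki } : ReducedParams).faultOn
      qoriaV3p08_δ0 tf) :
    Tendsto δ atTop (𝓝 qoriaV3p08_δ0) := by
  rw [faultOn_scaled, show (1 : ℝ) / 10 * tf = tf / 10 by ring] at h0
  exact qoriaV3p08.csa_recovers (by positivity) hlt htd hsat hunsat h0

end InverterDroop

end Summit.Ventures.GridStability.Models

end
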